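import Summits.BirchSwinnertonDyer.BirchSwinnertonDyer.Theorems.PublishedInputsGreenbergLemma34FormalCount
import Summits.BirchSwinnertonDyer.BirchSwinnertonDyer.Theorems.PublishedInputsGreenbergLemma34FixedCount
import Summits.BirchSwinnertonDyer.BirchSwinnertonDyer.Theorems.ByReductionTypeAtTwoGoodOrdTowerControlDevissage
import HarnessLib

set_option linter.dupNamespace false -- `…BirchSwinnertonDyer.BirchSwinnertonDyer…` is the cell's nested layout (D-0017)
set_option autoImplicit false

/-!
# Greenberg LNM 1716 Lemma 3.4 at `n = 0`, step 6: the whole `p`-primary part of the formal-group coinvariants,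
# `#(Ê(𝔪̄)^{H_∞}/(g − 1))[p^∞] = #{τ-fixed reductions}[p^∞]` (finite), over `ℚ` at `v ∣ p`

Seat `bsd-inputs-k4-p1` (gen 5; LADDER-BSD D-0154 KEY (147)(f) «prove the printed input», row 1 K4 INPUTS; Greenberg
1999), `--supports stmt-BirchSwinnertonDyer-20309`. THEOREMS ONLY (no definition, no named fact, no `sorry`).

R. Greenberg, *Iwasawa theory for elliptic curves*, LNM 1716 (1999), §2 Prop. 2.5 (p. 80) / §3 Lemma 3.4 (p. 89): the
factor `|ker(a_v)| = |H¹(F_v, 𝓕(𝔪̄))| = |Ẽ(f)_p|`. From the depth-`p^k` counts of the prequels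
(`natCard_torsionBy_coinv_formal_eq`: `#(M₁/D₁M₁)[p^k] = #(Ê[p^k])^τ`; `natCard_fixed_formalTorsion_eq_natCard_fixed_reduction`:
`= #{τ-fixed reductions}[p^k]`), the uniform bound by the finite set `SF` of `τ`-fixed reductions
(`GoodOrdTower.finite_and_natCard_le_of_forall_torsionBy_le`) and a common exponent:

* `natCard_primaryComponent_coinv_formal_eq` — in the setting of `natCard_torsionBy_coinv_formal_eq` (any depth):
  `(M₁/D₁M₁)[p^∞]` is FINITE and **`#(M₁/D₁M₁)[p^∞] = #{y ∈ B : y p-power torsion, y a τ-fixed reduction}`**.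

HONEST FRAMING: a local TOOL theorem with displayed hypotheses; closes nothing; no summit statement is proved; BSD is
not proved by any of this.

References: [GreenbergLNM1716] §2 Prop. 2.5 (p. 80), §3 Lemma 3.4 (pp. 89–90).
-/

noncomputable section

open scoped Classical NNReal

namespace Summit.BirchSwinnertonDyer.BirchSwinnertonDyer.Theorems.InputsGreenbergLemma34

open CategoryTheory NumberField IsDedekindDomain Field
  Literature.NumberTheory.GaloisRepresentations Literature.NumberTheory.GaloisRepresentations.DiscreteGaloisModule
  IsDedekindDomain.HeightOneSpectrum Literature.NumberTheory.EllipticCurves.FormalGroupChart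
  _root_.TopRep _root_.ContRepresentation _root_.ContinuousCohomology WeierstrassCurve
  Summit.BirchSwinnertonDyer.BirchSwinnertonDyer.Theorems.GoodOrdTower
open Literature.NumberTheory.EllipticCurves hiding subgroupIncl

variable {p : ℕ} [hp : Fact p.Prime] {κ : ZpExtension ℚ p}

set_option maxHeartbeats 1600000 in
/-- **`#(M₁/D₁M₁)[p^∞] = #{τ-fixed reductions}[p^∞]`, and `(M₁/D₁M₁)[p^∞]` is finite** — the factor `|ker(a_v)|` of
Greenberg's Lemma 3.4 at `n = 0` over `ℚ`, in the `red₀`-currency of `natCard_torsionBy_coinv_formal_eq` (same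
hypotheses, all depths at once; `SF` a finite set containing the `τ`-fixed reductions).
[cite: GreenbergLNM1716, §2 Prop. 2.5 (p. 80), §3 Lemma 3.4 (pp. 89–90)] -/
theorem natCard_primaryComponent_coinv_formal_eq (hκ : κ.IsCyclotomic) (v : HeightOneSpectrum (𝓞 ℚ))
    (hv : ((p : ℕ) : 𝓞 ℚ) ∈ v.asIdeal)
    (W : WeierstrassCurve ℚ) [W.IsElliptic]
    {w : Valuation (AlgebraicClosure (v.adicCompletion ℚ)) ℝ≥0}
    (hw : ∀ x, (w x : ℝ) = spectralNorm (v.adicCompletion ℚ) (AlgebraicClosure (v.adicCompletion ℚ)) x)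
    [hV : (W.baseChange (AlgebraicClosure (v.adicCompletion ℚ))).IsIntegral w.integer]
    [(W.baseChange (AlgebraicClosure (v.adicCompletion ℚ))).IsElliptic]
    [hVL : (W.baseChange (IntermediateField.fixedField
        (localSubgroup (κ.layerSubgroup 0) (v.adicCompletion ℚ)) :
          IntermediateField (v.adicCompletion ℚ) (AlgebraicClosure (v.adicCompletion ℚ)))).IsIntegral
      (w.comap (algebraMap (IntermediateField.fixedField
        (localSubgroup (κ.layerSubgroup 0) (v.adicCompletion ℚ)) :
          IntermediateField (v.adicCompletion ℚ) (AlgebraicClosure (v.adicCompletion ℚ)))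
        (AlgebraicClosure (v.adicCompletion ℚ)))).integer]
    {B : Type} [AddCommGroup B] (red₀ : localPoints W (v.adicCompletion ℚ) →+ B)
    (hker : ∀ Q : localPoints W (v.adicCompletion ℚ), red₀ Q = 0 ↔
      (Q : (W.baseChange (AlgebraicClosure (v.adicCompletion ℚ))).toAffine.Point) ∈
        kernel w (W.baseChange (AlgebraicClosure (v.adicCompletion ℚ))))
    (hstab : ∀ (σ : absoluteGaloisGroup (v.adicCompletion ℚ)) (Q : localPoints W (v.adicCompletion ℚ)),
      red₀ Q = 0 → red₀ (σ • Q) = 0)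
    (hdiv₁ : ∀ a : localPoints W (v.adicCompletion ℚ), red₀ a = 0 →
      ∃ b : localPoints W (v.adicCompletion ℚ), red₀ b = 0 ∧ p • b = a)
    (hgenr : ∀ r : ℕ, ∃ P₁ : localPoints W (v.adicCompletion ℚ), red₀ P₁ = 0 ∧ addOrderOf P₁ = p ^ r ∧
      ∀ P : localPoints W (v.adicCompletion ℚ), red₀ P = 0 → ((p ^ r : ℕ) : ℤ) • P = 0 → ∃ c : ℕ, P = c • P₁)
    (hsurj : ∀ (r : ℕ) (y : B), ((p ^ r : ℕ) : ℤ) • y = 0 →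
      ∃ x : localPoints W (v.adicCompletion ℚ), ((p ^ r : ℕ) : ℤ) • x = 0 ∧ red₀ x = y)
    {τ : absoluteGaloisGroup (v.adicCompletion ℚ)}
    (hτfix : ∀ (r : ℕ) (ξ : AlgebraicClosure (v.adicCompletion ℚ)), ξ ^ p ^ r = 1 → τ • ξ = ξ)
    (hHensel : ∀ Q : localPoints W (v.adicCompletion ℚ), red₀ (τ • Q) = red₀ Q →
      ∃ P₀ : localPoints W (v.adicCompletion ℚ),
        (∀ σ : absoluteGaloisGroup (v.adicCompletion ℚ), σ • P₀ = P₀) ∧ red₀ P₀ = red₀ Q)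
    (κE : ZpExtension (v.adicCompletion ℚ) p)
    (hkerE : κE.kerSubgroup = localSubgroup κ.kerSubgroup (v.adicCompletion ℚ))
    {g : absoluteGaloisGroup (v.adicCompletion ℚ)} (hγ : κE.IsTopGenerator g)
    (M₁ : AddSubgroup (localPoints W (v.adicCompletion ℚ)))
    (hM₁ : ∀ a, a ∈ M₁ ↔ a ∈ red₀.ker ∧ ∀ h ∈ localSubgroup κ.kerSubgroup (v.adicCompletion ℚ), h • a = a)
    (D₁ : M₁ →+ M₁) (hD₁ : ∀ a : M₁, ((D₁ a : M₁) : localPoints W (v.adicCompletion ℚ)) = g • (a : _) - a)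
    (hCG : ∀ ψ : contOneCocycles (discreteTopRep κE.kerSubgroup (localPoints W (v.adicCompletion ℚ))),
      (∀ τ', red₀ (ψ.1 τ') = 0) →
        ∃ e : localPoints W (v.adicCompletion ℚ), red₀ e = 0 ∧
          ∀ τ' : κE.kerSubgroup, ψ.1 τ' = (τ' : absoluteGaloisGroup (v.adicCompletion ℚ)) • e - e)
    (SF : Finset B) (hSF : ∀ Q : localPoints W (v.adicCompletion ℚ), red₀ (τ • Q) = red₀ Q → red₀ Q ∈ SF) :
    Finite (AddCommGroup.primaryComponent (M₁ ⧸ D₁.range) p) ∧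
      Nat.card (AddCommGroup.primaryComponent (M₁ ⧸ D₁.range) p) =
        Nat.card {y : B // (∃ n : ℕ, p ^ n • y = 0) ∧
          ∃ Q : localPoints W (v.adicCompletion ℚ), red₀ Q = y ∧ red₀ (τ • Q) = y} := by
  -- notation
  let K := v.adicCompletion ℚ
  let P : Type := localPoints W K
  let X₁ := M₁ ⧸ D₁.range
  have hpr : ∀ r : ℕ, p ^ r ≠ 0 := fun r ↦ pow_ne_zero r hp.out.ne_zero
  -- the `τ`-fixed reductions and their `p`-primary part `S`
  let Sp : Type := {y : B // (∃ n : ℕ, p ^ n • y = 0) ∧ ∃ Q : P, red₀ Q = y ∧ red₀ (τ • Q) = y}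
  have hSinj : Function.Injective (fun y : Sp ↦ (⟨y.1, by
      obtain ⟨-, Q, hQ, hτQ⟩ := y.2
      rw [← hQ]; exact hSF Q (by rw [hτQ, hQ])⟩ : ↥SF)) := fun a b h ↦
    Subtype.ext (congrArg (fun z : ↥SF ↦ (z : B)) h)
  haveI hSfin : Finite Sp := Finite.of_injective _ hSinj
  -- depth `p^k`: `#X₁[p^k] = #{y ∈ B : p^k y = 0, y a τ-fixed reduction} ≤ #SF`
  have hdepth : ∀ k : ℕ, Finite {c : X₁ // p ^ k • c = 0} ∧
      Nat.card {c : X₁ // p ^ k • c = 0} =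
        Nat.card {y : B // ((p ^ k : ℕ) : ℤ) • y = 0 ∧ ∃ Q : P, red₀ Q = y ∧ red₀ (τ • Q) = y} := by
    intro k
    let C : AddSubgroup P := red₀.ker ⊓ AddSubgroup.torsionBy P ((p ^ k : ℕ) : ℤ)
    have hC : ∀ a : P, a ∈ C ↔ red₀ a = 0 ∧ p ^ k • a = 0 := fun a ↦ by
      change a ∈ red₀.ker ⊓ AddSubgroup.torsionBy P ((p ^ k : ℕ) : ℤ) ↔ _
      rw [AddSubgroup.mem_inf, AddMonoidHom.mem_ker]
      exact and_congr Iff.rfl AddSubgroup.torsionBy.nsmul_iff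
    obtain ⟨hfin, hcount⟩ := natCard_torsionBy_coinv_formal_eq hκ v hv W k hw red₀ hker hstab hdiv₁ hgenr hsurj
      hτfix hHensel κE hkerE hγ M₁ hM₁ D₁ hD₁ hCG C hC
    refine ⟨hfin, hcount.trans ?_⟩
    exact @natCard_fixed_formalTorsion_eq_natCard_fixed_reduction ℚ _ W _ K _ _
      (charZero_of_injective_algebraMap (algebraMap ℚ K).injective) p _ B _ red₀ hstab hgenr hsurj τ hτfix k C hC
  have hle : ∀ k : ℕ, Nat.card {c : X₁ // p ^ k • c = 0} ≤ SF.card := by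
    intro k
    rw [(hdepth k).2, ← Nat.card_eq_finsetCard SF]
    refine Nat.card_le_card_of_injective (fun y ↦ (⟨y.1, by
      obtain ⟨-, Q, hQ, hτQ⟩ := y.2
      rw [← hQ]; exact hSF Q (by rw [hτQ, hQ])⟩ : ↥SF)) fun a b h ↦
      Subtype.ext (congrArg (fun z : ↥SF ↦ (z : B)) h)
  -- `X₁[p^∞]` is finite
  let T : AddSubgroup X₁ := AddCommGroup.primaryComponent X₁ p
  have hT : ∀ c : X₁, c ∈ T ↔ ∃ n : ℕ, p ^ n • c = 0 := fun c ↦ AddCommGroup.mem_primaryComponent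
  have eTk : ∀ k : ℕ, {a : T // p ^ k • a = 0} ≃ {c : X₁ // p ^ k • c = 0} := fun k ↦
    { toFun := fun a ↦ ⟨(a.1 : X₁), by
        have h := congrArg (fun z : T ↦ (z : X₁)) a.2
        simpa only [AddSubmonoidClass.coe_nsmul, ZeroMemClass.coe_zero] using h⟩
      invFun := fun c ↦ ⟨⟨c.1, (hT _).mpr ⟨k, c.2⟩⟩, Subtype.ext (by
        rw [AddSubmonoidClass.coe_nsmul, ZeroMemClass.coe_zero]; exact c.2)⟩
      left_inv := fun a ↦ Subtype.ext (Subtype.ext rfl)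
      right_inv := fun c ↦ Subtype.ext rfl }
  obtain ⟨hTfin, -⟩ := finite_and_natCard_le_of_forall_torsionBy_le p (A := T)
    (fun a ↦ by
      obtain ⟨n, hn⟩ := (hT _).mp a.2
      exact ⟨n, Subtype.ext (by rw [AddSubmonoidClass.coe_nsmul, ZeroMemClass.coe_zero]; exact hn)⟩)
    (B := SF.card) (fun k ↦ by haveI := (hdepth k).1; exact Finite.of_equiv _ (eTk k).symm)
    (fun k ↦ by rw [Nat.card_congr (eTk k)]; exact hle k)
  haveI := hTfin
  refine ⟨hTfin, ?_⟩
  -- common exponents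
  have hexpT : ∃ K₀ : ℕ, ∀ a : T, p ^ K₀ • a = 0 := by
    haveI : Fintype T := Fintype.ofFinite T
    have hprim : ∀ a : T, ∃ n : ℕ, p ^ n • a = 0 := fun a ↦ by
      obtain ⟨n, hn⟩ := (hT _).mp a.2
      exact ⟨n, Subtype.ext (by rw [AddSubmonoidClass.coe_nsmul, ZeroMemClass.coe_zero]; exact hn)⟩
    choose n hn using hprim
    refine ⟨Finset.univ.sup n, fun a ↦ ?_⟩
    obtain ⟨d, hd⟩ := Nat.exists_eq_add_of_le (Finset.le_sup (f := n) (Finset.mem_univ a))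
    rw [hd, pow_add, mul_comm, mul_smul, hn a, smul_zero]
  have hexpS : ∃ K₁ : ℕ, ∀ y : Sp, p ^ K₁ • (y : B) = 0 := by
    haveI : Fintype Sp := Fintype.ofFinite Sp
    choose n hn using fun y : Sp ↦ y.2.1
    refine ⟨Finset.univ.sup n, fun y ↦ ?_⟩
    obtain ⟨d, hd⟩ := Nat.exists_eq_add_of_le (Finset.le_sup (f := n) (Finset.mem_univ y))
    rw [hd, pow_add, mul_comm, mul_smul, hn y, smul_zero]
  obtain ⟨K₀, hK₀⟩ := hexpT
  obtain ⟨K₁, hK₁⟩ := hexpS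
  -- at depth `K = K₀ + K₁` both sides are the whole `p`-primary parts
  have e1 : Nat.card T = Nat.card {c : X₁ // p ^ (K₀ + K₁) • c = 0} := by
    rw [← Nat.card_congr (eTk (K₀ + K₁))]
    refine Nat.card_congr ?_
    exact
      { toFun := fun a ↦ ⟨a, by rw [pow_add, mul_comm, mul_smul, hK₀ a, smul_zero]⟩
        invFun := fun a ↦ a.1
        left_inv := fun a ↦ rfl
        right_inv := fun a ↦ Subtype.ext rfl }
  have e2 : Nat.card {y : B // ((p ^ (K₀ + K₁) : ℕ) : ℤ) • y = 0 ∧ ∃ Q : P, red₀ Q = y ∧ red₀ (τ • Q) = y} =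
      Nat.card Sp := by
    refine Nat.card_congr ?_
    exact
      { toFun := fun y ↦ ⟨y.1, ⟨K₀ + K₁, by rw [← natCast_zsmul]; exact y.2.1⟩, y.2.2⟩
        invFun := fun y ↦ ⟨y.1, by
          rw [natCast_zsmul, pow_add, mul_smul, hK₁ y, smul_zero], y.2.2⟩
        left_inv := fun y ↦ Subtype.ext rfl
        right_inv := fun y ↦ Subtype.ext rfl }
  rw [e1, (hdepth (K₀ + K₁)).2, e2]

end Summit.BirchSwinnertonDyer.BirchSwinnertonDyer.Theorems.InputsGreenbergLemma34

end
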